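import Summits.QuantumFields.GaugeBoot.SchwingerDysonDeterminesWilson
import Summits.QuantumFields.GaugeBoot.OneLinkShiftCalculus
import Summits.QuantumFields.GaugeBoot.HaarShiftStrongCouplingClasses
import HarnessLib

/-!
# On `ℤ^d` the Schwinger–Dyson (derivative-form loop) equations are the DLR equations (gauge-boot, Class B supplement)

HONEST FRAMING (cell `pub-gaugeboot`, page 1 of every file): the venture produces certified bounds
on lattice expectations at stated coupling, gauge group, dimension and torus size; NOT a mass gap,
NOT a continuum limit, NOT a string tension; NOT Yang–Mills-summit-bearing (barriers
`FixedCouplingUltralocality`, `PerturbativeInvisibility`). This module is a structural statement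
about the class of states a loop-equation SDP quantifies over; it certifies no number.

## Content

`ClassB.lean` axiomatises the bootstrap's states on `ℤ^d` by the MEASURE form of the loop
equations, `IsHaarShiftState ρ β μ` (one-link Haar-shift identity on continuous cylinder
observables), and `HaarShiftDLR.lean` identified it with the DLR property. The SDP rows themselves
are the DERIVATIVE form — the Schwinger–Dyson identities `∫ f' dμ = β ∫ f S_e' dμ` along
`U ↦ U[e ↦ e^{tX} U_e]` (`SchwingerDysonStates.IsSchwingerDysonState`, local actions
`S_e = wilsonBoundaryAction ρ {e}`). This file proves that on `ℤ^d` the two coincide: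

* `IsHaarShiftState.integral_comp_update_mul_of_continuous` — the Haar-shift identity of a
  probability state extends from continuous cylinder observables to ALL continuous observables
  (the tilted state `e^{β S_e} dμ` is shift invariant as a measure, `HaarShiftDLR`);
* ★★ `isSchwingerDysonState_iff_isHaarShiftState`, ★★ `isSchwingerDysonState_iff_mem_ymGibbsMeasures`
  — for a probability measure on `LGConfig d G` (`G` compact metrisable, `ρ` continuous, EVERY real
  `β`, every `d`), a family of continuous one-parameter subgroups exhausting `G` along which the
  local actions are differentiable: Schwinger–Dyson state ⇔ Haar-shift state ⇔ DLR state;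
* ★★★ `isSchwingerDysonState_iff_mem_ymGibbsMeasures_of_exp` — unconditional form for families
  realised as matrix exponentials through `ρ` (`ρ(k_a t) = e^{tX_a}`; differentiability from
  `OneLinkShiftCalculus`), and ★★★ `…_suN` / `…_uN`: for `SU(N)` / `U(N)` in the fundamental
  representation with the exponential shifts `e^{tX}`, `X ∈ 𝔰𝔲(N)` / `𝔲(N)`, a probability measure
  on the gauge configurations of `ℤ^d` satisfies all one-link Schwinger–Dyson identities iff it is
  an infinite-volume Gibbs (DLR) state of the Wilson action at `β`;
* `ClassBState.isSchwingerDysonState_suN` — every Class-B state of `SU(N)` is a Schwinger–Dyson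
  state; ★★ `IsSchwingerDysonState.eq_of_small_suN` — at strong coupling `6(d-1)N|β| < 1` the
  derivative-form loop equations have a UNIQUE probability solution on `ℤ^d` (Dobrushin, via
  `HaarShiftUniqueness`), which is the infinite-volume limit of the torus states.

References: E. Seiler, LNP 159 (1982) Ch. 2; H.-O. Georgii, *Gibbs Measures and Phase
Transitions* (2011) Thm. 1.33; S. Chatterjee, arXiv:1502.07719 §3; V. Kazakov, Z. Zheng,
arXiv:2203.11360 §3; H. Shen, R. Zhu, X. Zhu, arXiv:2204.12737. Folklore.
-/

noncomputable section

open MeasureTheory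
open scoped Matrix.Norms.Frobenius
open Literature.MathematicalPhysics.QuantumLattice
open Literature.MathematicalPhysics.QuantumFieldTheory (haarProbability)

namespace Summit.QuantumFields.GaugeBoot

section General

variable {d N : ℕ} {G : Type*} [Group G] [TopologicalSpace G] [IsTopologicalGroup G]
  [CompactSpace G] [MeasurableSpace G] [BorelSpace G] [SecondCountableTopology G] [T2Space G]
  (ρ : G →* Matrix (Fin N) (Fin N) ℂ) {K : Type*} {k : K → ℝ → G}

/-- **The Haar-shift identity of a probability state holds for every continuous observable**, not
only for cylinder ones: the tilted state `e^{β S_e} dμ / Z` is invariant under the shifts of the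
link `e` as a measure (`IsHaarShiftState.map_update_mul_tilted`); undo the tilt. [folklore] -/
theorem IsHaarShiftState.integral_comp_update_mul_of_continuous (hρ : Continuous ρ) {β : ℝ}
    {μ : Measure (LGConfig d G)} [IsProbabilityMeasure μ] (hμ : IsHaarShiftState ρ β μ)
    (e : ZdEdge d) (g : G) (F : LGConfig d G → ℝ) (hF : Continuous F) :
    ∫ U, F (Function.update U e (g * U e)) ∂μ =
      ∫ U, F U * Real.exp (-(β * (wilsonBoundaryAction ρ {e} (Function.update U e (g⁻¹ * U e)) -
        wilsonBoundaryAction ρ {e} U))) ∂μ := by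
  set S : LGConfig d G → ℝ := wilsonBoundaryAction ρ {e} with hSdef
  have hS : Continuous S := continuous_wilsonBoundaryAction ρ hρ _
  have hw : Continuous fun U : LGConfig d G => Real.exp (β * S U) :=
    Real.continuous_exp.comp (continuous_const.mul hS)
  obtain ⟨Cw, hCw⟩ := isCompact_univ.exists_bound_of_continuousOn hw.continuousOn
  have hwi : Integrable (fun U : LGConfig d G => Real.exp (β * S U)) μ :=
    Integrable.of_bound hw.aestronglyMeasurable Cw (ae_of_all _ fun U => hCw U (Set.mem_univ U))
  have hZ : 0 < ∫ U, Real.exp (β * S U) ∂μ := integral_exp_pos hwi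
  -- shift invariance of the tilted measure, on the continuous observable `K = F · e^{-β S ∘ T_{g⁻¹}}`
  have hν := hμ.map_update_mul_tilted ρ hρ e g
  have hτ : Measurable fun U : LGConfig d G => Function.update U e (g * U e) :=
    measurable_update_mul e g
  set K : LGConfig d G → ℝ := fun U => F U * Real.exp (-(β * S (Function.update U e (g⁻¹ * U e))))
    with hKdef
  have hKc : Continuous K :=
    hF.mul (Real.continuous_exp.comp (continuous_const.mul (hS.comp (continuous_update_mul e g⁻¹))).neg)
  have h1 : ∫ U, K (Function.update U e (g * U e)) ∂(μ.tilted fun U => β * S U) =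
      ∫ U, K U ∂(μ.tilted fun U => β * S U) := by
    conv_rhs => rw [← hν]
    rw [integral_map hτ.aemeasurable hKc.aestronglyMeasurable]
  rw [integral_tilted, integral_tilted] at h1
  -- pointwise simplification of both integrands
  have hL : ∀ U : LGConfig d G, (Real.exp (β * S U) / ∫ V, Real.exp (β * S V) ∂μ) •
      K (Function.update U e (g * U e)) =
      (∫ V, Real.exp (β * S V) ∂μ)⁻¹ * F (Function.update U e (g * U e)) := fun U => by
    simp only [hKdef, smul_eq_mul, update_mul_update_inv_mul]
    have e1 : Real.exp (β * S U) * Real.exp (-(β * S U)) = 1 := by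
      rw [← Real.exp_add, add_neg_cancel, Real.exp_zero]
    calc Real.exp (β * S U) / (∫ V, Real.exp (β * S V) ∂μ) *
          (F (Function.update U e (g * U e)) * Real.exp (-(β * S U)))
        = (∫ V, Real.exp (β * S V) ∂μ)⁻¹ * F (Function.update U e (g * U e)) *
            (Real.exp (β * S U) * Real.exp (-(β * S U))) := by ring
      _ = (∫ V, Real.exp (β * S V) ∂μ)⁻¹ * F (Function.update U e (g * U e)) := by
          rw [e1, mul_one]
  have hR : ∀ U : LGConfig d G, (Real.exp (β * S U) / ∫ V, Real.exp (β * S V) ∂μ) • K U =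
      (∫ V, Real.exp (β * S V) ∂μ)⁻¹ * (F U * Real.exp (-(β * (S (Function.update U e (g⁻¹ * U e))
        - S U)))) := fun U => by
    simp only [hKdef, smul_eq_mul]
    have e2 : Real.exp (β * S U) * Real.exp (-(β * S (Function.update U e (g⁻¹ * U e)))) =
        Real.exp (-(β * (S (Function.update U e (g⁻¹ * U e)) - S U))) := by
      rw [← Real.exp_add]
      congr 1
      ring
    calc Real.exp (β * S U) / (∫ V, Real.exp (β * S V) ∂μ) *
          (F U * Real.exp (-(β * S (Function.update U e (g⁻¹ * U e)))))
        = (∫ V, Real.exp (β * S V) ∂μ)⁻¹ * (F U * (Real.exp (β * S U) *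
            Real.exp (-(β * S (Function.update U e (g⁻¹ * U e)))))) := by ring
      _ = _ := by rw [e2]
  simp_rw [hL, hR] at h1
  rw [integral_const_mul, integral_const_mul] at h1
  exact mul_left_cancel₀ (inv_ne_zero hZ.ne') h1

omit [T2Space G] in
/-- **A Schwinger–Dyson state of `ℤ^d` is a Haar-shift state** (family of continuous
one-parameter subgroups exhausting `G`, `ρ` continuous, any finite `μ`, any real `β`). [folklore] -/
theorem IsSchwingerDysonState.isHaarShiftState (hkc : ∀ a, Continuous (k a))
    (hk : ∀ a s t, k a (s + t) = k a s * k a t) (hG : ∀ g : G, ∃ a t, k a t = g)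
    (hρ : Continuous ρ) {β : ℝ} {μ : Measure (LGConfig d G)} [IsFiniteMeasure μ]
    (hμ : IsSchwingerDysonState k (fun e => wilsonBoundaryAction ρ {e}) β μ) :
    IsHaarShiftState ρ β μ := fun e g f _ _ hf =>
  hμ.haarShift hkc hk hG (fun e => continuous_wilsonBoundaryAction ρ hρ {e}) e g f hf

/-- **A Haar-shift probability state of `ℤ^d` is a Schwinger–Dyson state** along every family of
continuous one-parameter subgroups along which the local actions `S_e` are differentiable with
continuous derivative. [folklore] -/
theorem IsHaarShiftState.isSchwingerDysonState (hkc : ∀ a, Continuous (k a))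
    (hk : ∀ a s t, k a (s + t) = k a s * k a t) (hρ : Continuous ρ)
    (hSd : ∀ (e : ZdEdge d) (a : K), ∃ S' : LGConfig d G → ℝ, Continuous S' ∧
      ∀ U, HasDerivAt (fun t => wilsonBoundaryAction ρ {e} (Function.update U e (k a t * U e)))
        (S' U) 0)
    {β : ℝ} {μ : Measure (LGConfig d G)} [IsProbabilityMeasure μ] (hμ : IsHaarShiftState ρ β μ) :
    IsSchwingerDysonState k (fun e => wilsonBoundaryAction ρ {e}) β μ :=
  isSchwingerDysonState_of_haarShift hkc hk (fun e => continuous_wilsonBoundaryAction ρ hρ {e}) hSd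
    fun e g F hF => hμ.integral_comp_update_mul_of_continuous ρ hρ e g F hF

/-- ★★ **On `ℤ^d` the derivative form and the measure form of the loop equations coincide**: for a
probability measure on `LGConfig d G` (`G` compact metrisable, `ρ` continuous, any real `β`), a
family of continuous one-parameter subgroups exhausting `G` along which the local actions are
differentiable: `IsSchwingerDysonState ⇔ IsHaarShiftState`. [folklore] -/
theorem isSchwingerDysonState_iff_isHaarShiftState (hkc : ∀ a, Continuous (k a))
    (hk : ∀ a s t, k a (s + t) = k a s * k a t) (hG : ∀ g : G, ∃ a t, k a t = g)
    (hρ : Continuous ρ)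
    (hSd : ∀ (e : ZdEdge d) (a : K), ∃ S' : LGConfig d G → ℝ, Continuous S' ∧
      ∀ U, HasDerivAt (fun t => wilsonBoundaryAction ρ {e} (Function.update U e (k a t * U e)))
        (S' U) 0)
    (β : ℝ) (μ : Measure (LGConfig d G)) [IsProbabilityMeasure μ] :
    IsSchwingerDysonState k (fun e => wilsonBoundaryAction ρ {e}) β μ ↔ IsHaarShiftState ρ β μ :=
  ⟨fun hμ => hμ.isHaarShiftState ρ hkc hk hG hρ, fun hμ => hμ.isSchwingerDysonState ρ hkc hk hρ hSd⟩

/-- ★★ **On `ℤ^d` the Schwinger–Dyson states are exactly the DLR states** of the Wilson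
specification (`HaarShiftDLR.isHaarShiftState_iff_mem_ymGibbsMeasures`): under the hypotheses of
`isSchwingerDysonState_iff_isHaarShiftState`,
`IsSchwingerDysonState k S β μ ↔ μ ∈ ymGibbsMeasures ρ β`. [folklore] -/
theorem isSchwingerDysonState_iff_mem_ymGibbsMeasures (hkc : ∀ a, Continuous (k a))
    (hk : ∀ a s t, k a (s + t) = k a s * k a t) (hG : ∀ g : G, ∃ a t, k a t = g)
    (hρ : Continuous ρ)
    (hSd : ∀ (e : ZdEdge d) (a : K), ∃ S' : LGConfig d G → ℝ, Continuous S' ∧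
      ∀ U, HasDerivAt (fun t => wilsonBoundaryAction ρ {e} (Function.update U e (k a t * U e)))
        (S' U) 0)
    (β : ℝ) (μ : Measure (LGConfig d G)) [IsProbabilityMeasure μ] :
    IsSchwingerDysonState k (fun e => wilsonBoundaryAction ρ {e}) β μ ↔ μ ∈ ymGibbsMeasures ρ β := by
  rw [isSchwingerDysonState_iff_isHaarShiftState ρ hkc hk hG hρ hSd β μ,
    isHaarShiftState_iff_mem_ymGibbsMeasures ρ hρ]

/-- ★★★ **Exponential families**: if the one-parameter subgroups are realised as matrix
exponentials through `ρ` (`ρ(k_a t) = e^{tX_a}`) — so that the local actions are differentiable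
along them by `exists_hasDerivAt_wilsonBoundaryAction_oneLink` — and exhaust `G`, then for every
probability measure on the gauge configurations of `ℤ^d` and every real `β`:
Schwinger–Dyson state ⇔ DLR state. [folklore] -/
theorem isSchwingerDysonState_iff_mem_ymGibbsMeasures_of_exp (hkc : ∀ a, Continuous (k a))
    (hk : ∀ a s t, k a (s + t) = k a s * k a t) (hG : ∀ g : G, ∃ a t, k a t = g)
    (hρ : Continuous ρ) {X : K → Matrix (Fin N) (Fin N) ℂ}
    (hX : ∀ a t, ρ (k a t) = NormedSpace.exp ((t : ℂ) • X a)) (β : ℝ) (μ : Measure (LGConfig d G))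
    [IsProbabilityMeasure μ] :
    IsSchwingerDysonState k (fun e => wilsonBoundaryAction ρ {e}) β μ ↔ μ ∈ ymGibbsMeasures ρ β :=
  isSchwingerDysonState_iff_mem_ymGibbsMeasures ρ hkc hk hG hρ
    (fun e a => exists_hasDerivAt_wilsonBoundaryAction_oneLink ρ hρ (hk a) (hX a) {e} e) β μ

end General

/-! ## `SU(N)` and `U(N)` with the exponential one-parameter subgroups -/

section Unitary

variable {d : ℕ}

/-- ★★★ **`SU(N)` lattice Yang–Mills on `ℤ^d`, fundamental representation, ANY real `β`, any
`d`, `N`: a probability measure on the gauge configurations satisfies the one-link Schwinger–Dyson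
identities `∫ f' dμ = β ∫ f S_e' dμ` for every link `e`, every direction `X ∈ 𝔰𝔲(N)` and every
continuous observable differentiable along `U ↦ U[e ↦ e^{tX} U_e]` — the derivative form of the
loop equations — IF AND ONLY IF it is an infinite-volume Gibbs (DLR) state of the Wilson action.**
[folklore] -/
theorem isSchwingerDysonState_iff_mem_ymGibbsMeasures_suN (N : ℕ) (β : ℝ)
    (μ : Measure (LGConfig d (Matrix.specialUnitaryGroup (Fin N) ℂ))) [IsProbabilityMeasure μ] :
    IsSchwingerDysonState (suExp N) (fun e => wilsonBoundaryAction (fundamentalRep (Fin N)) {e}) β μ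
      ↔ μ ∈ ymGibbsMeasures (fundamentalRep (Fin N)) β :=
  isSchwingerDysonState_iff_mem_ymGibbsMeasures_of_exp (fundamentalRep (Fin N)) (continuous_suExp N)
    (suExp_add N) (fun g => exists_suExp_eq N g) (continuous_fundamentalRep _)
    (X := fun X : SuGenerator N => (X : Matrix (Fin N) (Fin N) ℂ))
    (fun X t => by rw [fundamentalRep_apply, coe_suExp, Complex.coe_smul]) β μ

/-- ★★★ **`U(N)` lattice gauge theory on `ℤ^d`, fundamental representation, ANY real `β`:
Schwinger–Dyson state (along the exponential shifts `e^{tX}`, `X ∈ 𝔲(N)`) ⇔ DLR state.**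
[folklore] -/
theorem isSchwingerDysonState_iff_mem_ymGibbsMeasures_uN (N : ℕ) (β : ℝ)
    (μ : Measure (LGConfig d (Matrix.unitaryGroup (Fin N) ℂ))) [IsProbabilityMeasure μ] :
    IsSchwingerDysonState (uExp N) (fun e => wilsonBoundaryAction (unitaryFundamentalRep (Fin N) ℂ)
      {e}) β μ ↔ μ ∈ ymGibbsMeasures (unitaryFundamentalRep (Fin N) ℂ) β :=
  isSchwingerDysonState_iff_mem_ymGibbsMeasures_of_exp (unitaryFundamentalRep (Fin N) ℂ)
    (continuous_uExp N) (uExp_add N) (fun g => exists_uExp_eq N g)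
    (continuous_unitaryFundamentalRep _ _) (X := fun X : UGenerator N => (X : Matrix (Fin N) (Fin N) ℂ))
    (fun X t => by rw [unitaryFundamentalRep_apply, coe_uExp, Complex.coe_smul]) β μ

/-- **`SU(N)`: Schwinger–Dyson state ⇔ Haar-shift state** (the `haarShift` axiom of `ClassBState`).
[folklore] -/
theorem isSchwingerDysonState_iff_isHaarShiftState_suN (N : ℕ) (β : ℝ)
    (μ : Measure (LGConfig d (Matrix.specialUnitaryGroup (Fin N) ℂ))) [IsProbabilityMeasure μ] :
    IsSchwingerDysonState (suExp N) (fun e => wilsonBoundaryAction (fundamentalRep (Fin N)) {e}) β μ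
      ↔ IsHaarShiftState (fundamentalRep (Fin N)) β μ :=
  isSchwingerDysonState_iff_isHaarShiftState (fundamentalRep (Fin N)) (continuous_suExp N)
    (suExp_add N) (fun g => exists_suExp_eq N g) (continuous_fundamentalRep _)
    (fun e X => exists_hasDerivAt_wilsonBoundaryAction_oneLink (fundamentalRep (Fin N))
      (continuous_fundamentalRep _) (suExp_add N X) (X := (X : Matrix (Fin N) (Fin N) ℂ))
      (fun t => by rw [fundamentalRep_apply, coe_suExp, Complex.coe_smul]) {e} e) β μ

/-- **Every Class-B state of `SU(N)` lattice Yang–Mills is a Schwinger–Dyson state**: the states a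
Class-B certificate quantifies over satisfy every derivative-form loop equation (all links, all
directions, all continuous observables differentiable along the shift). [folklore] -/
theorem ClassBState.isSchwingerDysonState_suN {N : ℕ} {β : ℝ}
    (ω : ClassBState d (fundamentalRep (Fin N)) β) :
    IsSchwingerDysonState (suExp N) (fun e => wilsonBoundaryAction (fundamentalRep (Fin N)) {e})
      β ω.μ := by
  haveI := ω.isProbabilityMeasure
  exact (isSchwingerDysonState_iff_isHaarShiftState_suN N β ω.μ).2 ω.haarShift

/-- ★★ **Every infinite-volume limit point of the `SU(N)` torus Wilson states satisfies the
derivative-form loop equations on `ℤ^d`** (all links, all directions `X ∈ 𝔰𝔲(N)`, all continuous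
observables differentiable along the shift) — the premise of the infinite-volume lattice bootstrap
(Anderson–Kruczenski, Kazakov–Zheng), here a theorem: limit points are DLR states
(`isHaarShiftState_of_mem_infiniteVolumeLimitPoints`). [folklore] -/
theorem isSchwingerDysonState_suN_of_mem_infiniteVolumeLimitPoints {N : ℕ} {β : ℝ}
    {μ : Measure (LGConfig d (Matrix.specialUnitaryGroup (Fin N) ℂ))}
    (hμ : μ ∈ infiniteVolumeLimitPoints (d := d) (fundamentalRep (Fin N)) β) :
    IsSchwingerDysonState (suExp N) (fun e => wilsonBoundaryAction (fundamentalRep (Fin N)) {e})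
      β μ := by
  obtain ⟨L, hLm, hL⟩ := hμ
  haveI := hL.1
  exact (isSchwingerDysonState_iff_isHaarShiftState_suN N β μ).2
    (isHaarShiftState_of_mem_infiniteVolumeLimitPoints (fundamentalRep (Fin N))
      (continuous_fundamentalRep _) ⟨L, hLm, hL⟩)

/-- **Every Class-T (tilted) state of `SU(N)` is a Schwinger–Dyson state.** [folklore] -/
theorem TiltedRP.TiltedClassState.isSchwingerDysonState_suN {i j : Fin d} {N : ℕ} {β : ℝ}
    (ω : TiltedRP.TiltedClassState d i j (fundamentalRep (Fin N)) β) :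
    IsSchwingerDysonState (suExp N) (fun e => wilsonBoundaryAction (fundamentalRep (Fin N)) {e})
      β ω.μ := by
  haveI := ω.isProbabilityMeasure
  exact (isSchwingerDysonState_iff_isHaarShiftState_suN N β ω.μ).2 ω.haarShift

/-- ★★ **At strong coupling the derivative-form loop equations have a UNIQUE probability solution
on `ℤ^d`**: for `SU(N)`, every `N`, `d` and `6(d-1)N|β| < 1`, any two Schwinger–Dyson probability
states coincide (they are DLR states; Dobrushin uniqueness, `IsHaarShiftState.eq_of_small`).
[folklore] -/
theorem IsSchwingerDysonState.eq_of_small_suN {N : ℕ} {β : ℝ}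
    (hβ : 6 * ((d - 1 : ℕ) : ℝ) * N * |β| < 1)
    {μ ν : Measure (LGConfig d (Matrix.specialUnitaryGroup (Fin N) ℂ))} [IsProbabilityMeasure μ]
    [IsProbabilityMeasure ν]
    (hμ : IsSchwingerDysonState (suExp N) (fun e => wilsonBoundaryAction (fundamentalRep (Fin N)) {e})
      β μ)
    (hν : IsSchwingerDysonState (suExp N) (fun e => wilsonBoundaryAction (fundamentalRep (Fin N)) {e})
      β ν) : μ = ν :=
  IsHaarShiftState.eq_of_small (fundamentalRep (Fin N)) (continuous_fundamentalRep _) hβ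
    ((isSchwingerDysonState_iff_isHaarShiftState_suN N β μ).1 hμ)
    ((isSchwingerDysonState_iff_isHaarShiftState_suN N β ν).1 hν)

/-- ★★ **At strong coupling the unique Schwinger–Dyson probability state of `SU(N)` on `ℤ^d` IS the
infinite-volume limit of the torus Wilson states** (`IsHaarShiftState.isInfiniteVolumeLimit_of_small`).
[folklore] -/
theorem IsSchwingerDysonState.isInfiniteVolumeLimit_of_small_suN {N : ℕ} {β : ℝ}
    (hβ : 6 * ((d - 1 : ℕ) : ℝ) * N * |β| < 1)
    {μ : Measure (LGConfig d (Matrix.specialUnitaryGroup (Fin N) ℂ))} [IsProbabilityMeasure μ]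
    (hμ : IsSchwingerDysonState (suExp N) (fun e => wilsonBoundaryAction (fundamentalRep (Fin N)) {e})
      β μ) :
    IsInfiniteVolumeLimit (d := d) (fundamentalRep (Fin N)) β μ :=
  IsHaarShiftState.isInfiniteVolumeLimit_of_small (fundamentalRep (Fin N)) (continuous_fundamentalRep _)
    hβ ((isSchwingerDysonState_iff_isHaarShiftState_suN N β μ).1 hμ)

end Unitary

end Summit.QuantumFields.GaugeBoot

end
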